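import Literature.AlgebraicGeometry.Resolution.PermissibleBlowup
import HarnessLib

/-!
# Near points: the order of the weak transform under a permissible blowing up (CoP1, Prop. 4.2 (a))

Topic: `Literature/AlgebraicGeometry/Resolution`. [CoP1] = Cossart–Piltant, J. Algebra 320
(2008), proof of Prop. 4.2, "Near and very near points", p. 8:

> "let `Y = V(y_1, …, y_r)` be permissible for `E` at `x` (so `r = 2` or `r = 3`). Let `E′` be
> the transform of `E` in the blowing up `X′` of `(X, x)` along `Y`, i.e. `E′ = (J′, μ)` where
> `J′ = I(Y)^{-μ} J` is the weak transform of `J`. … (a) For any point `x′` above `x`,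
> `ord_{x′} J′ ≤ μ`; if equality holds, we say that `x′` is near `x`. … To prove (a), let
> `f ∈ I` with `ord_x f = μ` … `F(Y_1, Y_2, Y_3) := in_x f ∈ k(x)[Y_1, …, Y_r]` … (10). In the
> chart of `X′` where, say `y_1′ := y_1` is an equation of the exceptional divisor,
> `y_1^{-μ} f ≡ F(1, y_2′, y_3′) mod (y_1′, y_3′)` (resp. `mod (y_1′)`) … (11) … Now (11)
> proves (a), since `ord_{x′} J′ ≤ deg F = μ`."

PROVED here for an arbitrary regular centre `Y ⊆ {x | ord_x J = μ}` of a regular locally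
Noetherian scheme (any codimension `r`; `PointBlowupOrder.lean` is the case `Y = {x}`):

* chart algebra over a local ring `R` with a quasi-regular sequence `c` in `𝔪` (the centre
  `P = (c)`): `exists_chartResidueMap` — the reduction `ρ : B_j = R[P/c_j] → (R/𝔪)[T_l : l ≠ j]`
  of the chart modulo `𝔪 B_j` (surjective, kernel `𝔪 B_j`, `ρ(F(e)) = F̄(T_j := 1)`);
  `map_residue_ne_zero_of_eval_not_mem_pow_succ` — a form `F` of degree `μ` in `c` with
  `F(c) ∉ 𝔪^{μ+1}` has `F̄ ≠ 0`; `eval₂Hom_chartGen_not_mem_maximalIdeal_pow_of_le` — (11):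
  `ord_𝔴 F(e) ≤ μ` at every prime `𝔴 ⊇ 𝔪 B_j`;
* `IsBlowup.not_stalkIdeal_controlledTransform_le_pow_of_mem`,
  `IsBlowup.idealOrder_controlledTransform_le_of_mem` — **(a): `ord_{x′} J′ ≤ μ` for every
  point `x′` of the blowing up over a point of the centre.**

## Sources

* V. Cossart, O. Piltant, J. Algebra 320 (2008) 1051–1082, proof of Prop. 4.2, (10)–(11) and
  (a), p. 8. [CossartPiltant2008]
* H. Hironaka, Ann. of Math. 79 (1964), Ch. III (the invariant `ν` under permissible blowing
  ups) — background.
-/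

noncomputable section

open CategoryTheory CategoryTheory.Limits AlgebraicGeometry TopologicalSpace IsLocalRing

namespace Literature.AlgebraicGeometry.Resolution

universe u

open Scheme.IdealSheafData

/-! ## Chart algebra: the chart modulo `𝔪` -/

section Chart

variable {R : Type u} [CommRing R] [IsLocalRing R] {k : ℕ} (c : Fin k → R) (j : Fin k)

/-- **The chart modulo the maximal ideal of the base.** For a quasi-regular sequence `c` in the
maximal ideal `𝔪` of a local ring `R` there is a surjection
`ρ : B_j = (R[(c)t])_{(c_j t)} → (R/𝔪)[T_l : l ≠ j]` with kernel `𝔪 B_j`, under which the weak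
transform `F(e)` of a form `F` goes to `F̄(T_j := 1)` — the composite of
`B_j/(c_j) ≅ (R/(c))[T]` (`chartQuotEquiv`) with the reduction `R/(c) → R/𝔪` of coefficients
(in [CoP1] (11): reading `y_1^{-μ} f` modulo `(y_1′, y_3′)`, the fibre over `x`).
[cite: CossartPiltant2008, proof of Prop. 4.2, (11)] -/
theorem exists_chartResidueMap (hcq : IsQuasiRegular c) (hcm : ∀ l, c l ∈ maximalIdeal R) :
    ∃ ρ : chartRing c j →+* MvPolynomial {l : Fin k // l ≠ j} (R ⧸ maximalIdeal R),
      Function.Surjective ρ ∧ RingHom.ker ρ = (maximalIdeal R).map (chartBase c j) ∧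
      ∀ F : MvPolynomial (Fin k) R,
        ρ (MvPolynomial.eval₂Hom (chartBase c j) (fun l => chartGen c j l) F) =
          MvPolynomial.map (Ideal.Quotient.mk (maximalIdeal R)) (dehomogenize j F) := by
  classical
  have hle : Ideal.span (Set.range c) ≤ maximalIdeal R :=
    Ideal.span_le.mpr (by rintro _ ⟨l, rfl⟩; exact hcm l)
  -- `ρ₁ : B_j → (R/(c))[T]` with kernel `(φ c_j)`
  obtain ⟨ρ₁, hρ₁⟩ : ∃ ρ₁ : chartRing c j →+* MvPolynomial {l : Fin k // l ≠ j}
      (R ⧸ Ideal.span (Set.range c)),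
      ρ₁ = (chartQuotEquiv c j hcq).symm.toRingHom.comp
        (Ideal.Quotient.mk (Ideal.span {chartBase c j (c j)})) := ⟨_, rfl⟩
  have hρ₁surj : Function.Surjective ρ₁ := by
    rw [hρ₁]
    exact (chartQuotEquiv c j hcq).symm.surjective.comp Ideal.Quotient.mk_surjective
  have hρ₁ker : RingHom.ker ρ₁ = Ideal.span {chartBase c j (c j)} := by
    ext b
    rw [hρ₁, RingHom.mem_ker, RingHom.comp_apply, RingEquiv.toRingHom_eq_coe,
      RingEquiv.coe_toRingHom, EmbeddingLike.map_eq_zero_iff, Ideal.Quotient.eq_zero_iff_mem]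
  have hρ₁φ : ∀ r : R, ρ₁ (chartBase c j r) =
      MvPolynomial.C (Ideal.Quotient.mk (Ideal.span (Set.range c)) r) := by
    intro r
    rw [hρ₁, RingHom.comp_apply, RingEquiv.toRingHom_eq_coe, RingEquiv.coe_toRingHom,
      RingEquiv.symm_apply_eq, chartQuotEquiv_apply, chartQuotMap_C]
  have hρ₁F : ∀ F : MvPolynomial (Fin k) R,
      ρ₁ (MvPolynomial.eval₂Hom (chartBase c j) (fun l => chartGen c j l) F) =
        MvPolynomial.map (Ideal.Quotient.mk _) (dehomogenize j F) := by
    intro F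
    have hquot : chartQuotMap c j (MvPolynomial.map (Ideal.Quotient.mk _) (dehomogenize j F)) =
        Ideal.Quotient.mk (Ideal.span {chartBase c j (c j)})
          (MvPolynomial.eval₂Hom (chartBase c j) (fun l => chartGen c j l) F) := by
      rw [← RingHom.comp_apply, chartQuotMap_comp_map, RingHom.comp_apply]
      congr 1
      exact RingHom.congr_fun (eval₂Hom_comp_aeval_kill c j) F
    rw [hρ₁, RingHom.comp_apply, RingEquiv.toRingHom_eq_coe, RingEquiv.coe_toRingHom,
      RingEquiv.symm_apply_eq, chartQuotEquiv_apply]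
    exact hquot.symm
  -- `ρ₂ : (R/(c))[T] → (R/𝔪)[T]`, reduction of coefficients
  obtain ⟨ρ₂, hρ₂⟩ : ∃ ρ₂ : MvPolynomial {l : Fin k // l ≠ j} (R ⧸ Ideal.span (Set.range c)) →+*
      MvPolynomial {l : Fin k // l ≠ j} (R ⧸ maximalIdeal R),
      ρ₂ = MvPolynomial.map (Ideal.Quotient.factor hle) := ⟨_, rfl⟩
  have hfs : Function.Surjective (Ideal.Quotient.factor hle) := fun y => by
    obtain ⟨r, rfl⟩ := Ideal.Quotient.mk_surjective y
    exact ⟨Ideal.Quotient.mk _ r, Ideal.Quotient.factor_mk hle r⟩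
  have hρ₂surj : Function.Surjective ρ₂ := hρ₂ ▸ MvPolynomial.map_surjective _ hfs
  have hfk : RingHom.ker (Ideal.Quotient.factor hle) =
      (maximalIdeal R).map (Ideal.Quotient.mk (Ideal.span (Set.range c))) := by
    apply le_antisymm
    · intro y hy
      obtain ⟨r, rfl⟩ := Ideal.Quotient.mk_surjective y
      rw [RingHom.mem_ker, Ideal.Quotient.factor_mk, Ideal.Quotient.eq_zero_iff_mem] at hy
      exact Ideal.mem_map_of_mem _ hy
    · rw [Ideal.map_le_iff_le_comap]
      intro r hr
      rw [Ideal.mem_comap, RingHom.mem_ker, Ideal.Quotient.factor_mk, Ideal.Quotient.eq_zero_iff_mem]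
      exact hr
  refine ⟨ρ₂.comp ρ₁, hρ₂surj.comp hρ₁surj, ?_, fun F => ?_⟩
  · -- the kernel is `𝔪 B_j`
    have hKle : Ideal.span {chartBase c j (c j)} ≤ (maximalIdeal R).map (chartBase c j) := by
      rw [Ideal.span_singleton_le_iff_mem]
      exact Ideal.mem_map_of_mem _ (hcm j)
    have hcomp : (MvPolynomial.C.comp (Ideal.Quotient.mk (Ideal.span (Set.range c))) :
        R →+* MvPolynomial {l : Fin k // l ≠ j} (R ⧸ Ideal.span (Set.range c))) =
        ρ₁.comp (chartBase c j) := by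
      ext r
      rw [RingHom.comp_apply, RingHom.comp_apply, hρ₁φ]
    rw [← RingHom.comap_ker, hρ₂, MvPolynomial.ker_map, hfk, Ideal.map_map, hcomp,
      ← Ideal.map_map, Ideal.comap_map_of_surjective ρ₁ hρ₁surj, ← RingHom.ker_eq_comap_bot,
      hρ₁ker, sup_eq_left.mpr hKle]
  · rw [RingHom.comp_apply, hρ₁F, hρ₂, MvPolynomial.map_map]
    congr 1

/-- **The initial form of an element of order `μ` lying in `P^μ` is non-zero**: for a form `F`
of degree `μ` in elements `c` of `𝔪` with `F(c) ∉ 𝔪^{μ+1}`, the reduction `F̄` modulo `𝔪` is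
non-zero (a form with coefficients in `𝔪` takes its value in `𝔪 · (c)^μ ⊆ 𝔪^{μ+1}`); in [CoP1]:
`in_x f = F(Y_1, …, Y_r) ≠ 0`. [cite: CossartPiltant2008, proof of Prop. 4.2, (10)] -/
theorem map_residue_ne_zero_of_eval_not_mem_pow_succ (hcm : ∀ l, c l ∈ maximalIdeal R)
    {F : MvPolynomial (Fin k) R} {μ : ℕ} (hF : F.IsHomogeneous μ)
    (hFc : MvPolynomial.eval c F ∉ maximalIdeal R ^ (μ + 1)) :
    MvPolynomial.map (Ideal.Quotient.mk (maximalIdeal R)) F ≠ 0 := by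
  intro h0
  apply hFc
  have hle : Ideal.span (Set.range c) ≤ maximalIdeal R :=
    Ideal.span_le.mpr (by rintro _ ⟨l, rfl⟩; exact hcm l)
  have hcoeff : F ∈ Ideal.map (MvPolynomial.C : R →+* MvPolynomial (Fin k) R) (maximalIdeal R) := by
    rw [MvPolynomial.mem_map_C_iff]
    intro m
    have := congrArg (MvPolynomial.coeff m) h0
    rw [MvPolynomial.coeff_map, MvPolynomial.coeff_zero, Ideal.Quotient.eq_zero_iff_mem] at this
    exact this
  have h1 := eval_mem_mul_span_pow c hF hcoeff
  rw [pow_succ']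
  exact Ideal.mul_mono_right (Ideal.pow_right_mono hle μ) h1

/-- **[CoP1] (11) and (a), chart form, for an arbitrary regular centre**: for a form `F` of
degree `μ` in the quasi-regular sequence `c ⊆ 𝔪` (the centre `P = (c)`) with `F̄ ≠ 0`, the weak
transform `f′ = F(e)` on the chart `B_j` has `f′ ∉ 𝔴^{μ+1}(B_j)_𝔴` at every prime `𝔴 ⊇ 𝔪 B_j`
(a point of the blowing up over the closed point): modulo `𝔪 B_j`, `f′ ↦ F̄(T_j := 1)`, a
non-zero polynomial of degree `≤ μ` over the residue field, whose order at any prime is `≤ μ`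
(`TaylorOrderBound.lean`). [cite: CossartPiltant2008, proof of Prop. 4.2, (11) and (a)] -/
theorem eval₂Hom_chartGen_not_mem_maximalIdeal_pow_of_le (hcq : IsQuasiRegular c)
    (hcm : ∀ l, c l ∈ maximalIdeal R) {F : MvPolynomial (Fin k) R} {μ : ℕ}
    (hF : F.IsHomogeneous μ) (hF0 : MvPolynomial.map (Ideal.Quotient.mk (maximalIdeal R)) F ≠ 0)
    (𝔴 : Ideal (chartRing c j)) [𝔴.IsPrime] (h𝔴 : (maximalIdeal R).map (chartBase c j) ≤ 𝔴) :
    (algebraMap (chartRing c j) (Localization.AtPrime 𝔴) :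
        chartRing c j →+* Localization.AtPrime 𝔴)
        (MvPolynomial.eval₂Hom (chartBase c j) (fun l => chartGen c j l) F) ∉
      maximalIdeal (Localization.AtPrime 𝔴) ^ (μ + 1) := by
  classical
  intro hmem
  letI : Field (R ⧸ maximalIdeal R) := Ideal.Quotient.field _
  obtain ⟨ρ, hρsurj, hρker, hρF⟩ := exists_chartResidueMap c j hcq hcm
  -- `g = F̄(T_j := 1) ≠ 0`, of degree `≤ μ`
  have hg0 : MvPolynomial.map (Ideal.Quotient.mk (maximalIdeal R)) (dehomogenize j F) ≠ 0 := by
    rw [map_dehomogenize]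
    exact dehomogenize_ne_zero_of_isHomogeneous j (hF.map _) hF0
  have hgdeg : (MvPolynomial.map (Ideal.Quotient.mk (maximalIdeal R)) (dehomogenize j F)).totalDegree
      ≤ μ :=
    (totalDegree_map_le _ _).trans ((totalDegree_dehomogenize_le j F).trans hF.totalDegree_le)
  -- the prime `𝔮 = ρ(𝔴)` and the local homomorphism `(B_j)_𝔴 → k[T]_𝔮`
  have hker : RingHom.ker ρ ≤ 𝔴 := hρker.trans_le h𝔴
  haveI h𝔮 : (𝔴.map ρ).IsPrime := Ideal.map_isPrime_of_surjective hρsurj hker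
  have hcomap : 𝔴 = (𝔴.map ρ).comap ρ := by
    rw [Ideal.comap_map_of_surjective ρ hρsurj, ← RingHom.ker_eq_comap_bot, sup_eq_left.mpr hker]
  have hb := algebraMap_mvPolynomial_not_mem_maximalIdeal_pow (𝔴.map ρ)
    (Localization.AtPrime (𝔴.map ρ)) hg0 (Nat.lt_succ_of_le hgdeg)
  rw [← hρF] at hb
  exact algebraMap_not_mem_maximalIdeal_pow_of_comap_eq ρ 𝔴 (𝔴.map ρ) hcomap hb hmem

end Chart

/-! ## (a): the order of the weak transform at points over the centre -/

section Scheme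

variable {X X' : Scheme.{u}} {π : X' ⟶ X}

set_option maxHeartbeats 400000 in
/-- **[CoP1] Prop. 4.2, proof, (a), for an arbitrary permissible centre: `J′_{x′} ⊄ 𝔪_{x′}^{μ+1}`.**
Let `π` be a blowing up of the regular locally Noetherian `X` along a regular centre
`Y ⊆ {x | ord_x J = μ}` and `x′` a point over `x ∈ Y`. Then the stalk at `x′` of the weak
transform `J′ = (J𝒪_{X′} : 𝓘_E^μ)` is not contained in `𝔪_{x′}^{μ+1}`: with `P = 𝓘_{Y,x} = (c)`,
`c` quasi-regular, `J_x ⊆ P^μ` (`le_vanishingIdeal_pow_of_forall_idealOrder_eq`), an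
`f ∈ J_x ∖ 𝔪_x^{μ+1}` is `F(c)` for a form `F` of degree `μ` with `F̄ ≠ 0`, and on the chart
`φ(f) = φ(c_j)^μ F(e)` with `ord_𝔴 F(e) ≤ μ` (`eval₂Hom_chartGen_not_mem_maximalIdeal_pow_of_le`),
`F(e) ∈ J′_{x′}`. [cite: CossartPiltant2008, proof of Prop. 4.2 (a)] -/
theorem IsBlowup.not_stalkIdeal_controlledTransform_le_pow_of_mem
    [IsLocallyNoetherian X] [IsLocallyNoetherian X'] (hX : Scheme.IsRegular X) {Y : Closeds X}
    (hreg : Scheme.IsRegular (vanishingIdeal Y).subscheme) (hπ : IsBlowup π (vanishingIdeal Y))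
    {J : X.IdealSheafData} {μ : ℕ} (hY : ∀ y ∈ (Y : Set X), idealOrder J y = μ) {x' : X'}
    (hx : π x' ∈ (Y : Set X)) :
    ¬ stalkIdeal (controlledTransform π (vanishingIdeal Y) J μ) x' ≤
      maximalIdeal (X'.presheaf.stalk x') ^ (μ + 1) := by
  classical
  intro hle
  haveI := hX (π x')
  have hxC : π x' ∈ (vanishingIdeal Y).support := by
    rw [← SetLike.mem_coe, coe_support_vanishingIdeal]
    exact hx
  obtain ⟨P, hPdef⟩ : ∃ P : Ideal (X.presheaf.stalk (π x')), P = stalkIdeal (vanishingIdeal Y) (π x') :=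
    ⟨_, rfl⟩
  have hPle : P ≤ maximalIdeal _ := hPdef ▸ (mem_support_iff_stalkIdeal_le _ (π x')).mp hxC
  haveI hPq : IsRegularLocalRing (X.presheaf.stalk (π x') ⧸ P) :=
    hPdef ▸ isRegularLocalRing_stalk_quotient_stalkIdeal hreg hxC
  -- quasi-regular generators `c` of `P`, all in `𝔪`
  obtain ⟨k, c, -, hcspan, hcq, -⟩ :=
    exists_isQuasiRegular_span_eq_of_isRegularLocalRing_quotient hPle (P : Set _) (Ideal.span_eq P)
  have hcm : ∀ l, c l ∈ maximalIdeal _ := fun l =>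
    hPle (hcspan ▸ Ideal.subset_span ⟨l, rfl⟩)
  -- the chart presentation `𝒪_{X',x'} = (B_j)_𝔴`, `𝔴 ⊇ 𝔪 B_j`
  obtain ⟨j, 𝔴, χ, hχ, hloc, h𝔴⟩ := hπ.exists_reesChart_stalk x' c (hcspan.trans hPdef)
  letI := χ.toAlgebra
  haveI : IsLocalization.AtPrime (X'.presheaf.stalk x') 𝔴.asIdeal := hloc
  have h𝔴' : (maximalIdeal _).map (chartBase c j) ≤ 𝔴.asIdeal := by
    rw [← h𝔴]
    exact Ideal.map_comap_le
  -- an element `f = F(c) ∈ J_x` of order exactly `μ`, `F` a form of degree `μ` with `F̄ ≠ 0`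
  have hord := hY (π x') hx
  have hJnot : ¬ stalkIdeal J (π x') ≤ maximalIdeal _ ^ (μ + 1) := by
    rw [← le_idealOrder_iff, hord]
    exact_mod_cast Nat.not_succ_le_self μ
  obtain ⟨f, hfJ, hf'⟩ := Set.not_subset.mp hJnot
  have hfP : f ∈ Ideal.span (Set.range c) ^ μ := by
    rw [hcspan, hPdef, ← stalkIdeal_pow]
    exact stalkIdeal_mono (le_vanishingIdeal_pow_of_forall_idealOrder_eq hX hreg hY) _ hfJ
  obtain ⟨F, hF, hFf⟩ := exists_isHomogeneous_of_mem_span_pow c μ hfP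
  have hF0 : MvPolynomial.map (Ideal.Quotient.mk (maximalIdeal _)) F ≠ 0 :=
    map_residue_ne_zero_of_eval_not_mem_pow_succ c hcm hF (by rw [hFf]; exact hf')
  have hfJ' : MvPolynomial.eval c F ∈ stalkIdeal J (π x') := by
    rw [hFf]
    exact hfJ
  have hff' := reesChartBase_eval_eq_pow_mul_eval₂ c j hF
  -- `ord_𝔴 F(e) ≤ μ` on the chart, and `χ F(e) ∈ J'_{x'}`
  have hford := eval₂Hom_chartGen_not_mem_maximalIdeal_pow_of_le c j hcq hcm hF hF0 𝔴.asIdeal h𝔴'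
  have hu : ∀ l, (π.stalkMap x').hom (c l) = (π.stalkMap x').hom (c j) * χ (chartGen c j l) :=
    fun l => by rw [← hχ, ← hχ, ← map_mul, ← reesChartBase_apply_eq_mul_chartGen c j l]
  have hCmap : (stalkIdeal (vanishingIdeal Y) (π x')).map (π.stalkMap x').hom =
      Ideal.span {χ (chartBase c j (c j))} := by
    rw [← hPdef, ← hcspan, Ideal.map_span_range_eq_span_singleton _ c j _ hu, ← hχ]
  have hmem : χ (MvPolynomial.eval₂Hom (chartBase c j) (fun l => chartGen c j l) F) ∈
      stalkIdeal (controlledTransform π (vanishingIdeal Y) J μ) x' := by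
    rw [controlledTransform, stalkIdeal_colon, stalkIdeal_pow, stalkIdeal_comap_eq_map_stalkMap,
      stalkIdeal_comap_eq_map_stalkMap, hCmap]
    exact map_mem_colon_of_eq_pow_mul (chartBase c j) χ (π.stalkMap x').hom hχ hff' hfJ'
  -- transport `ord_𝔴 ≤ μ` from `(B_j)_𝔴` to `𝒪_{X',x'}`
  exact algebraMap_not_mem_maximalIdeal_pow_of_isLocalization 𝔴.asIdeal hford (hle hmem)

/-- **[CoP1] (a): `ord_{x′} J′ ≤ μ` for every point `x′` over the permissible centre `Y`.**
[cite: CossartPiltant2008, proof of Prop. 4.2 (a)] -/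
theorem IsBlowup.idealOrder_controlledTransform_le_of_mem
    [IsLocallyNoetherian X] [IsLocallyNoetherian X'] (hX : Scheme.IsRegular X) {Y : Closeds X}
    (hreg : Scheme.IsRegular (vanishingIdeal Y).subscheme) (hπ : IsBlowup π (vanishingIdeal Y))
    {J : X.IdealSheafData} {μ : ℕ} (hY : ∀ y ∈ (Y : Set X), idealOrder J y = μ) {x' : X'}
    (hx : π x' ∈ (Y : Set X)) :
    idealOrder (controlledTransform π (vanishingIdeal Y) J μ) x' ≤ μ := by
  have := hπ.not_stalkIdeal_controlledTransform_le_pow_of_mem hX hreg hY hx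
  rw [← le_idealOrder_iff] at this
  by_contra h
  exact this (Order.add_one_le_of_lt (not_le.mp h))

/-- Together with the points off the exceptional divisor (where nothing changes): **if
`ord_x J ≤ μ` everywhere then `ord_{x′} J′ ≤ μ` everywhere** — the maximal order does not
increase under a permissible blowing up. [cite: CossartPiltant2008, proof of Prop. 4.2 (a)] -/
theorem IsBlowup.idealOrder_controlledTransform_le_of_forall
    [IsLocallyNoetherian X] [IsLocallyNoetherian X'] (hX : Scheme.IsRegular X) {Y : Closeds X}
    (hreg : Scheme.IsRegular (vanishingIdeal Y).subscheme) (hπ : IsBlowup π (vanishingIdeal Y))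
    {J : X.IdealSheafData} {μ : ℕ} (hY : ∀ y ∈ (Y : Set X), idealOrder J y = μ)
    (hJ : ∀ x, idealOrder J x ≤ μ) (x' : X') :
    idealOrder (controlledTransform π (vanishingIdeal Y) J μ) x' ≤ μ := by
  by_cases hx : π x' ∈ (Y : Set X)
  · exact hπ.idealOrder_controlledTransform_le_of_mem hX hreg hY hx
  · have hxC : π x' ∉ (vanishingIdeal Y).support := by
      rwa [← SetLike.mem_coe, coe_support_vanishingIdeal]
    -- off `E` the stalk of `J'` is the image of `J_{π x'}` under an isomorphism
    haveI := hπ.isIso_stalkMap_of_not_mem_support hxC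
    let ε : X.presheaf.stalk (π x') ≃+* X'.presheaf.stalk x' :=
      (asIso (π.stalkMap x')).commRingCatIsoToRingEquiv
    have hε : (ε : X.presheaf.stalk (π x') →+* X'.presheaf.stalk x') = (π.stalkMap x').hom := rfl
    refine le_trans ?_ (hJ (π x'))
    refine ENat.forall_natCast_le_iff_le.mp fun n hn => ?_
    rw [le_idealOrder_iff] at hn ⊢
    rw [stalkIdeal_controlledTransform_of_not_mem_support J μ hxC, ← hε] at hn
    intro a ha
    have h1 : (ε : X.presheaf.stalk (π x') →+* X'.presheaf.stalk x') a ∈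
        maximalIdeal (X'.presheaf.stalk x') ^ n := hn (Ideal.mem_map_of_mem _ ha)
    rw [RingHom.coe_coe, ← map_ringEquiv_maximalIdeal ε, ← Ideal.map_pow,
      ← Ideal.comap_symm, Ideal.mem_comap, RingEquiv.symm_apply_apply] at h1
    exact h1

end Scheme

end Literature.AlgebraicGeometry.Resolution

end
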